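import Summits.ResolutionOfSingularities.ResolutionOfSingularities.Theorems.PurelyInseparableDim4ChartStep
import Summits.ResolutionOfSingularities.ResolutionOfSingularities.Theorems.PurelyInseparableDim4CentreAdmissible
import Summits.ResolutionOfSingularities.ResolutionOfSingularities.Theorems.PurelyInseparableDim4PointStepChart
import Literature.AlgebraicGeometry.Hironaka2017.Lib.AffineCoordBlowupLSB
import Literature.AlgebraicGeometry.Hironaka2017.Lib.LSBPushforward
import HarnessLib

/-!
# Purely inseparable four-folds `z^p + F(x₁, …, x₄)`: the coordinate-centre walk IS a local sequence of
# permissible blow-ups (Hironaka's LSB, Def. 2.4–2.5 of the 2017 manuscript as TYPED in the tree) — brick (b)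
# «LSB form» of the TY-2 chart dictionary, cell `res-dim4-pi`, typ-2 g3

[OURS · counted 0] (D-0157 DOOR 2; director-resolution DR-157-C; desk WORD #66 (4): bricks (a) history, (c) joint
chains, (b) LSB form). The walk of record (`PIDim4.Step2` / `Step1h`: a Hironaka-permissible coordinate centre
`V(z, x_S)`, the `x_j`-chart, the point `b` of the exceptional hyperplane, cleaning — `CentreBlowup.step`) is, at
the scheme level, a LOCAL sequence of blow-ups in the sense of the tree's `Hironaka2017.S02Preliminaries.LSB`
(`cons U D rest`: an open `U ⊂ Z`, a closed `D ⊂ U`, the chosen blowing up `Bl_D U`, and so on): the opens are the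
re-centred, cleaned charts `U_k ≅ 𝔸⁵_K`, the centres the coordinate subspaces `V(z, x_{S_k}) ⊂ U_k`. Because an
LSB only asks the centre to be closed IN THE OPEN `U_k`, the history-dependent closedness of the (a)-bricks
(`…ChartChainHistory*`) plays no role here: EVERY chain of `Step2`-steps, monotone or not, is an LSB.

* §1 `isRegPermissibleCentre_chart` — through any chart `e : U ≅ 𝔸⁵` under which `E|_U` reads `((z^p + F)·𝒪, p)`,
  the subset `e⁻¹ V(z, x_S)` is a regular irreducible centre inside `Sing(E|_U)` as soon as `p ≤ ord_{(x_S)} F`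
  (row 001's `IdealExponent.IsRegPermissibleCentre`; Lib `isRegPermissibleCentre_CΛ` transported by
  `isRegPermissibleCentre_comap_iso_iff`, the order bound by `le_idealOrder_hypSheaf_of_mem_CΛ`).
* §2 **`exists_lsb_of_chain_step2`** — for every chart `(U, e)` of a scheme `Z` reading an ideal exponent `E = (J, p)`
  as `((z^p + s.F)·𝒪, p)` and every finite chain `s → s₁ → ⋯ → s_n` of `Step2 p` (any Hironaka-permissible
  coordinate centre at each step), there is an LSB `L` over `Z` of length `n`, `AllRegular`, `IsPermissibleFor E`,
  whose last transform `L.transform E` (row 002: iterated controlled transforms, Def. 2.1) reads `((z^p + s_n.F)·𝒪, p)`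
  on a chart `U' ≅ 𝔸⁵_K` of the last stage. Proof by induction on the chain from the root: the blow-up of `U` along
  `e^* 𝓘Λ` composed with `e` is a blowing up of `𝔸⁵` along `𝓘Λ` (`IsBlowup.comp_iso`), so typ-2's dictionary
  `controlledTransform_chart_eq_step` supplies the next chart; `exists_lsb_of_chain_step2_root` (`Z = 𝔸⁵`, `U = ⊤`,
  `E = ((z^p + s.F)·𝒪, p)`) and `exists_lsb_of_chain_step1h` (the MODE-1h walk of record) are the corollaries.

HONEST SCOPE. This is the LOCAL («S3-loc») form only: an LSB is not a marked resolution (no boundary, no claim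
that the last transform has empty singular locus, no globalisation of escaping centres — FC-2 / S3-glob), and
nothing here is a statement about termination of the walk. The manuscript's Def. 2.4–2.5 enter only as the tree's
TYPED carriers `LSB`, `LSB.transform`, `LSB.IsPermissibleFor` (nothing printed there is asserted). Nothing here
proves resolution of singularities in dimension ≥ 4 / characteristic `p` — NOT proved anywhere in this programme.
AI-produced formalisation, weaker than expert review. bears_on: LADDER-RESOLUTION:D157-DOOR2 (res-dim4-pi · S3 (b)).
-/

set_option linter.dupNamespace false -- D-0017: single-problem summit path `Summit.<S>.<S>.…` by design

noncomputable section

open MvPolynomial Finset CategoryTheory AlgebraicGeometry Opposite TopologicalSpace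
open AlgebraicGeometry.Scheme.IdealSheafData (vanishingIdeal)

namespace Summit.ResolutionOfSingularities.ResolutionOfSingularities.Theorems.PIDim4

open Literature.AlgebraicGeometry.Resolution
open Literature.AlgebraicGeometry.Resolution.AffinePointBlowup (P A γ coord Wtop)
open Literature.AlgebraicGeometry.Hironaka2017.S02Preliminaries

namespace ChartDictionary

/-! ## §1 One coordinate centre through a chart is a regular permissible centre -/

section Centre

variable {K : Type} [Field K] (p : ℕ) {S : Finset (Fin 4)}

/-- **A coordinate centre through a chart is a regular permissible centre.** If `e : U ≅ 𝔸⁵_K` is a chart of an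
open `U ⊂ Z` and `p ≤ ord_{(x_S)} F`, then for the ideal exponent `(e^*((z^p + F)·𝒪), p)` on `U` the closed subset
`e⁻¹ V(z, x_S)` is irreducible, its reduced subscheme is regular, and it lies in `Sing` (order `≥ p` at each of its
points) — row 001's `IsRegPermissibleCentre`. [cite: Hironaka2017, Def. 2.4 p.6 l.8–9 (unrefereed manuscript under
adjudication — kernel instance of the typed carrier, nothing of the manuscript asserted)]
[cite: BierstoneGrigorievMilmanWlodarczyk2011, Lemma 8.0.3 (2)] -/
theorem isRegPermissibleCentre_chart {Z : Scheme.{0}} (U : Z.Opens) (e : (U : Scheme.{0}) ≅ P 4 K)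
    (F : MvPolynomial (Fin 4) K) (hperm : (p : ℕ∞) ≤ CentreBlowup.ordAlong S F) :
    (⟨(hypSheaf p F).comap e.hom, p⟩ : IdealExponent (U : Scheme.{0})).IsRegPermissibleCentre
      ((AffineCoordBlowup.CΛ 4 K (insert 0 (Fin.succ '' (S : Set (Fin 4))))).preimage
        e.hom.base.hom.continuous) := by
  have hC : (AffineCoordBlowup.CΛ 4 K (insert 0 (Fin.succ '' (S : Set (Fin 4)))) : Set (P 4 K)) ⊆
      (⟨hypSheaf p F, p⟩ : IdealExponent (P 4 K)).sing := fun x hx =>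
    le_idealOrder_hypSheaf_of_mem_CΛ p S F hperm hx
  refine (IdealExponent.isRegPermissibleCentre_comap_iso_iff e ⟨hypSheaf p F, p⟩ _).mpr ?_
  have hpre : ((AffineCoordBlowup.CΛ 4 K (insert 0 (Fin.succ '' (S : Set (Fin 4))))).preimage
      e.hom.base.hom.continuous).preimage e.inv.base.hom.continuous =
      AffineCoordBlowup.CΛ 4 K (insert 0 (Fin.succ '' (S : Set (Fin 4)))) := by
    refine Closeds.ext (Set.ext fun x => ?_)
    change e.hom.base (e.inv.base x) ∈
        (AffineCoordBlowup.CΛ 4 K (insert 0 (Fin.succ '' (S : Set (Fin 4)))) : Set (P 4 K)) ↔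
      x ∈ (AffineCoordBlowup.CΛ 4 K (insert 0 (Fin.succ '' (S : Set (Fin 4)))) : Set (P 4 K))
    rw [← Scheme.Hom.comp_apply, Iso.inv_hom_id]
    rfl
  rw [hpre]
  exact Literature.AlgebraicGeometry.Hironaka2017.Lib.AffineCoordBlowupLSB.isRegPermissibleCentre_CΛ 4 K _ hC

/-- The reduced ideal of the chart centre `e⁻¹ V(z, x_S)` is `e^* 𝓘Λ`. [cite: GortzWedhorn2020, Prop. 13.91] -/
theorem vanishingIdeal_preimage_CΛ {Z : Scheme.{0}} (U : Z.Opens) (e : (U : Scheme.{0}) ≅ P 4 K)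
    (Λ : Set (Fin (4 + 1))) :
    vanishingIdeal ((AffineCoordBlowup.CΛ 4 K Λ).preimage e.hom.base.hom.continuous) =
      (AffineCoordBlowup.𝓘Λ 4 K Λ).comap e.hom :=
  (vanishingIdeal_comap_hom e (AffineCoordBlowup.CΛ 4 K Λ)).symm

/-- **Blowing up the chart centre and composing with the chart is a blowing up of `𝔸⁵` along `𝓘Λ`**
(`IsBlowup.comp_iso`), so the chart dictionary applies to it. [cite: GortzWedhorn2020, Prop. 13.91] -/
theorem isBlowup_blowupπ_comp_chart {Z : Scheme.{0}} (U : Z.Opens) (e : (U : Scheme.{0}) ≅ P 4 K)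
    (Λ : Set (Fin (4 + 1))) :
    IsBlowup (blowup.π (vanishingIdeal ((AffineCoordBlowup.CΛ 4 K Λ).preimage e.hom.base.hom.continuous)) ≫
        e.hom) (AffineCoordBlowup.𝓘Λ 4 K Λ) := by
  have h := (blowup.isBlowup (vanishingIdeal
    ((AffineCoordBlowup.CΛ 4 K Λ).preimage e.hom.base.hom.continuous))).comp_iso e
  have h2 : (vanishingIdeal ((AffineCoordBlowup.CΛ 4 K Λ).preimage e.hom.base.hom.continuous)).comap e.inv =
      AffineCoordBlowup.𝓘Λ 4 K Λ := by
    rw [vanishingIdeal_preimage_CΛ, ← Scheme.IdealSheafData.comap_comp, e.inv_hom_id,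
      Scheme.IdealSheafData.comap_id]
  rw [h2] at h
  exact h

/-- **The LSB transform through the chart**: Def. 2.1's transform of `E|_U = (J|_U, p)` under the blow-up of the chart
centre is the controlled transform of `(z^p + F)·𝒪` under the composite blowing up of `𝔸⁵` along `𝓘Λ` (both are
`colon`s of the same pulled-back ideals). [cite: BierstoneGrigorievMilmanWlodarczyk2011, §3.2] -/
theorem controlledTransform_blowupπ_chart {Z : Scheme.{0}} (U : Z.Opens) (e : (U : Scheme.{0}) ≅ P 4 K)
    (Λ : Set (Fin (4 + 1))) {J : Z.IdealSheafData} {F : MvPolynomial (Fin 4) K}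
    (hJ : J.comap U.ι = (hypSheaf p F).comap e.hom) (μ : ℕ) :
    controlledTransform
        (blowup.π (vanishingIdeal ((AffineCoordBlowup.CΛ 4 K Λ).preimage e.hom.base.hom.continuous)))
        (vanishingIdeal ((AffineCoordBlowup.CΛ 4 K Λ).preimage e.hom.base.hom.continuous)) (J.comap U.ι) μ =
      controlledTransform
        (blowup.π (vanishingIdeal ((AffineCoordBlowup.CΛ 4 K Λ).preimage e.hom.base.hom.continuous)) ≫ e.hom)
        (AffineCoordBlowup.𝓘Λ 4 K Λ) (hypSheaf p F) μ := by
  rw [controlledTransform, controlledTransform, Scheme.IdealSheafData.comap_comp,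
    Scheme.IdealSheafData.comap_comp, ← hJ, ← vanishingIdeal_preimage_CΛ]

end Centre

/-! ## §2 Every chain of `Step2`-steps is a permissible LSB -/

section Chain

variable {K : Type} [Field K] {p : ℕ} [hp : Fact p.Prime] [CharP K p] [PerfectRing K p] [DecidableEq K]

/-- **THE COORDINATE WALK IS AN LSB.** Let `Z` be a scheme with a chart `e : U ≅ 𝔸⁵_K` of an open `U ⊂ Z` under
which the ideal exponent `E = (J, p)` reads `((z^p + s.F)·𝒪, p)` (`J|_U = e^*((z^p + s.F)·𝒪)`), and let
`s → s₁ → ⋯ → s_n` be a chain of `Step2 p` (`List.IsChain (Step2 p) (s :: l)`; each step: a Hironaka-permissible coordinate centre `V(z, x_S)`,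
`p ≤ ord_{(x_S)}`, a chart `j ∈ S`, a point `b` of the exceptional hyperplane, cleaning). Then there is an LSB `L`
over `Z` (tree `Hironaka2017.S02Preliminaries.LSB`) with `L.length = n`, all of whose centres are regular and
irreducible (`AllRegular`) and which is permissible for `E` (`IsPermissibleFor`: every centre inside `Sing` of the
current transform), together with a chart `e' : U' ≅ 𝔸⁵_K` of its last stage under which `L.transform E` reads
`((z^p + s_n.F)·𝒪, p)`. The `k`-th step blows up `e_k⁻¹ V(z, x_{S_k})` inside the re-centred, cleaned chart `U_k`.
[cite: Hironaka2017, Def. 2.4–2.5 p.6 l.1–16 (unrefereed manuscript under adjudication — kernel instance of the typed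
carriers `LSB`, `LSB.transform`, `LSB.IsPermissibleFor`, nothing of the manuscript asserted)]
[cite: BierstoneGrigorievMilmanWlodarczyk2011, §3.2 with Lemma 8.0.3 (2)] [cite: Hauser2010, §§F–G] -/
theorem exists_lsb_of_chain_step2 (l : List (State K)) :
    ∀ {Z : Scheme.{0}} (U : Z.Opens) (e : (U : Scheme.{0}) ≅ P 4 K) (E : IdealExponent Z) (s : State K),
      E.b = p → E.J.comap U.ι = (hypSheaf p s.F).comap e.hom → List.IsChain (Step2 p) (s :: l) →
      ∃ L : LSB Z, L.length = l.length ∧ L.AllRegular ∧ L.IsPermissibleFor E ∧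
        ∃ (U' : L.top.Opens) (e' : (U' : Scheme.{0}) ≅ P 4 K), (L.transform E).b = p ∧
          (L.transform E).J.comap U'.ι =
            (hypSheaf p ((s :: l).getLast (List.cons_ne_nil s l)).F).comap e'.hom := by
  induction l with
  | nil =>
    intro Z U e E s hb hJ _
    exact ⟨LSB.nil Z, rfl, trivial, trivial, U, e, hb, hJ⟩
  | cons s' l ih =>
    intro Z U e E s hb hJ hchain
    rw [List.isChain_cons_cons] at hchain
    obtain ⟨⟨S, hS, j, b, hj, hbj, -, -, rfl⟩, hrest⟩ := hchain
    obtain ⟨J, b₀⟩ := E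
    obtain rfl : p = b₀ := hb.symm
    change J.comap U.ι = (hypSheaf p s.F).comap e.hom at hJ
    -- the centre of this step, a closed subset of the chart `U`, and the chosen blowing up of `U` along it
    set D : Closeds (U : Scheme.{0}) :=
      (AffineCoordBlowup.CΛ 4 K (insert 0 (Fin.succ '' (S : Set (Fin 4))))).preimage
        e.hom.base.hom.continuous with hD
    have hπ : IsBlowup (blowup.π (vanishingIdeal D) ≫ e.hom)
        (AffineCoordBlowup.𝓘Λ 4 K (insert 0 (Fin.succ '' (S : Set (Fin 4))))) :=
      isBlowup_blowupπ_comp_chart U e _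
    haveI : IsProper (blowup.π (vanishingIdeal D) ≫ e.hom) := hπ.isProper
    haveI : IsLocallyNoetherian (blowup (vanishingIdeal D)) :=
      LocallyOfFiniteType.isLocallyNoetherian (blowup.π (vanishingIdeal D) ≫ e.hom)
    -- the next chart: typ-2's dictionary (re-centring at `b`, cleaning)
    obtain ⟨Θ, -, -, -, hc⟩ := controlledTransform_chart_eq_step p hj hbj s hS.2 hπ
    haveI := Equimultiple.isOpenImmersion_specMap_algEquiv Θ
    set φ₀ : P 4 K ⟶ blowup (vanishingIdeal D) := Spec.map (CommRingCat.ofHom (Θ : A 4 K →+* A 4 K)) ≫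
      AffineCoordBlowup.chartImm hπ (succ_mem_centreVars hj) with hφ₀
    haveI : IsOpenImmersion φ₀ := by rw [hφ₀]; infer_instance
    have h1 : φ₀.isoOpensRange.inv ≫ φ₀ = φ₀.opensRange.ι :=
      (Iso.inv_comp_eq _).mpr (Scheme.Hom.isoOpensRange_hom_ι φ₀).symm
    -- Def. 2.1's transform of `E|_U`, read on the next chart
    have hCT := controlledTransform_blowupπ_chart p U e (insert 0 (Fin.succ '' (S : Set (Fin 4)))) hJ p
    have hread : (((⟨J, p⟩ : IdealExponent Z).restrict U).transform (blowup.π (vanishingIdeal D)) D).J.comap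
        φ₀.opensRange.ι = (hypSheaf p (CentreBlowup.step p S j b s).F).comap φ₀.isoOpensRange.symm.hom := by
      change (controlledTransform (blowup.π (vanishingIdeal D)) (vanishingIdeal D) (J.comap U.ι) p).comap _ = _
      rw [hCT, Iso.symm_hom, ← hc, ← Scheme.IdealSheafData.comap_comp, h1]
    -- the induction hypothesis on the blown-up stage
    obtain ⟨L₁, hlen, hreg, hpermL, U', e', hb', hJ'⟩ := ih φ₀.opensRange φ₀.isoOpensRange.symm
      (((⟨J, p⟩ : IdealExponent Z).restrict U).transform (blowup.π (vanishingIdeal D)) D)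
      (CentreBlowup.step p S j b s) rfl hread hrest
    have hcentre := isRegPermissibleCentre_chart p U e s.F hS.2
    refine ⟨LSB.cons U D L₁, ?_, ⟨hcentre.irreducible, hcentre.regular, hreg⟩, ⟨?_, hpermL⟩, U', e', hb', ?_⟩
    · change L₁.length + 1 = l.length + 1
      rw [hlen]
    · change (⟨J.comap U.ι, p⟩ : IdealExponent (U : Scheme.{0})).IsRegPermissibleCentre D
      rw [hJ]
      exact hcentre
    · change (L₁.transform (((⟨J, p⟩ : IdealExponent Z).restrict U).transform
        (blowup.π (vanishingIdeal D)) D)).J.comap U'.ι = _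
      rw [hJ']
      rfl

/-- **Root form**: every chain of `Step2 p` from a state `s` is realised by a permissible LSB over `𝔸⁵_K` for the
ideal exponent `((z^p + s.F)·𝒪, p)`, of the same length, whose last transform reads `((z^p + s_n.F)·𝒪, p)` on a
chart `≅ 𝔸⁵_K` of the last stage. [cite: Hironaka2017, Def. 2.4–2.5 p.6 l.1–16 (unrefereed manuscript under
adjudication — kernel instance of the typed carriers, nothing of the manuscript asserted)]
[cite: BierstoneGrigorievMilmanWlodarczyk2011, §3.2] -/
theorem exists_lsb_of_chain_step2_root (s : State K) (l : List (State K))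
    (hl : List.IsChain (Step2 p) (s :: l)) :
    ∃ L : LSB (P 4 K), L.length = l.length ∧ L.AllRegular ∧
      L.IsPermissibleFor (⟨hypSheaf p s.F, p⟩ : IdealExponent (P 4 K)) ∧
      ∃ (U' : L.top.Opens) (e' : (U' : Scheme.{0}) ≅ P 4 K),
        (L.transform ⟨hypSheaf p s.F, p⟩).b = p ∧
        (L.transform ⟨hypSheaf p s.F, p⟩).J.comap U'.ι =
          (hypSheaf p ((s :: l).getLast (List.cons_ne_nil s l)).F).comap e'.hom :=
  exists_lsb_of_chain_step2 l ⊤ (P 4 K).topIso ⟨hypSheaf p s.F, p⟩ s rfl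
    (by rw [Scheme.topIso_hom]) hl

/-- **The MODE-1h walk of record is a permissible LSB** (a `Step1h`-chain is a `Step2`-chain: the MODE-1h centre is
Hironaka-permissible). [cite: Hironaka2017, Def. 2.4–2.5 p.6 l.1–16 (unrefereed manuscript under adjudication —
kernel instance of the typed carriers, nothing of the manuscript asserted)] [cite: HauserPerlega2019PRIMS, §2] -/
theorem exists_lsb_of_chain_step1h (s : State K) (l : List (State K))
    (hl : List.IsChain (Step1h p) (s :: l)) :
    ∃ L : LSB (P 4 K), L.length = l.length ∧ L.AllRegular ∧
      L.IsPermissibleFor (⟨hypSheaf p s.F, p⟩ : IdealExponent (P 4 K)) ∧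
      ∃ (U' : L.top.Opens) (e' : (U' : Scheme.{0}) ≅ P 4 K),
        (L.transform ⟨hypSheaf p s.F, p⟩).b = p ∧
        (L.transform ⟨hypSheaf p s.F, p⟩).J.comap U'.ι =
          (hypSheaf p ((s :: l).getLast (List.cons_ne_nil s l)).F).comap e'.hom :=
  exists_lsb_of_chain_step2_root s l
    (List.IsChain.imp (fun t t' h => by obtain ⟨S, hS, hE⟩ := h; exact ⟨S, hS.1, hE⟩) hl)

end Chain

end ChartDictionary

end Summit.ResolutionOfSingularities.ResolutionOfSingularities.Theorems.PIDim4

end
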